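import Summits.QuantumFields.YangMills.Theorems.FluctuationComparisonRegPrIntLS2BetaSupTowerOfLiftLadderNestedSigma
import Summits.QuantumFields.YangMills.Theorems.FluctuationComparisonRegPrIntLS2BetaLiftLadderRowsDock
import Summits.QuantumFields.YangMills.Theorems.FluctuationComparisonRegPrIntLS2BetaLiftLadderDiscBudgetSplit
import HarnessLib

/-!
# S2β · THE SUP CHAIN — THE SUPPLIER KNIT, PER-GUARD EDITION (LEAD RULING №64 «PER-GUARD SOCKETS»; successor of ✓p836564's edition ⁗ «(E5) Σ-WINDOW AT α», DESK RULING №112):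
# AT A FIXED GUARD `G`, `hSTL⁗ G` — the (ST⁗) letter (= the (ST‴) hypothesis of ✓p834885
# `uniformFibreGapOrbit_of_supTowerFib` with ONE guard line `Σ_{i<K−J} ((5L)²∕4)·θ(K−i) ≤ α` inserted after the sup window) — FROM the station 3⁗ `…NestedSigma` (px10 g26), ✓`rows_dock`, ✓`hSCT_of_discSplit'` and
# TWO NAMED SUPPLIER LETTERS: the ARC-PROFILE letter (θ-generic, guard-indexed) and the SPLIT D′-BUDGET letter — the sup chain's gap list as the hypothesis list of ONE theorem

WHY THIS EDITION (RULING №64).  ✓p836564 `supTowerLetter4_of_arc_discSplit (hARC : ∀ G, …) (hDBX : ∀ G, …) : ∀ G, hSTL⁗ G` takes its two supplier letters as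
GUARD-UNIFORM binders; ✓∕⧗`…ArcLetterAbelianStratumFalse.not_forall_guard_arcLetter4` proves `¬ (∀ G, hARC⁗ G)` (the arc-profile letter is FALSE at the abelian guard `A′`:
a flat toron on the `6³` datum torus), so that binder is UNINHABITED and the ∀G knit can never be applied as a closed term.  Its PROOF was pointwise in `G`; this file
re-cuts the STATEMENT per guard: `supTowerLetter4_at (G) (hARC : ⟨arc-profile letter AT G⟩) (hDBX : ⟨split D′-budget letter AT G⟩) : hSTL⁗ G` — binder texts =
✓p836564's with the leading `∀ (G : …),` stripped, proof = ✓p836564's body verbatim with `G` fixed.  Consumers instantiate it at the guards where the letters are TRUE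
(px12's ✓`arcLetter_of_guard G hGs` for guards carrying the small-bond conjunct); the abelian stratum needs another road (LEAD №21∕№24).

Cell `ym3-torus` (YM ladder rung R3 = continuum `SU(2)` Yang–Mills on the three-torus at fixed lattice data — a RUNG: NOT d = 4, NOT infinite volume,
NOT a mass gap, NOT the Clay problem).  Width seat 3∕3 `ym-ust-20520-w3` (gen 29) = LEAD-20520 by lineage on crux `stmt-QuantumFields-20520`
(`…Theses.UnitScaleTilt.FluctuationComparisonRegPrIntL`); LINE g18-1 S2β, registered skeleton `Lines/semiclassical_s2beta.lean` 3732b7df UNTOUCHED (0∕5).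
ARCHITECT px17 g22 NAMED this pen (2026-08-31 21:16:47Z «THE SUPPLIER KNIT»; 21:27:23Z «no reshape»).  `--kind proof --supports stmt-QuantumFields-20520 --as helper`,
count-neutral, DEFINITION-FREE (0 `def`, 0 `instance`, 0 `notation`, 0 `sorry`); ONE decl-local `set_option maxHeartbeats 400000 in` as INSURANCE (README HEARTBEAT-BUDGET
form): with the witness `c` written explicitly the proof elaborates inside the 200k default (twin rc 0) but not at 150k — inside the cliff band, hence the line.

THE CHAIN BY KERNEL.  GAP♯∘ ⟸ ✓p834885 {h3, hD₁, hD₂, hSTL‴ := ∀ G, (ST‴) at `Ax := AxStage`}; (ST‴) ⟸ ✓p834059 §1 `supTowerLetter_of_liftLadderFbLetter‴`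
{the ONE-PROFILE letter: ∃ c, hTOP ∧ hREC ∧ hSCT_fb}; hTOP ∧ hREC ⟸ ✓`…LiftLadderRowsDock.rows_dock` (px21 g25) ⟸ {px20 ✓p834992 `topRow'`, ✓p832977 `liftRow'`,
the ARC PROFILE `hArc`}; hSCT_fb ⟸ ✓`…LiftLadderDiscBudgetSplit.hSCT_of_discSplit'` (px21 g25) ⟸ {(SPLIT), (SRC′)}; THIS FILE exhibits the station's constants and threads the two remaining letters:
  ★★★ `supTowerLetter4_of_arc_discSplit (hARC) (hDBX) : ∀ G, ⟨hSTL⁗ G⟩` (‴-edition: ✓`…SupTowerLetterOfSuppliers.supTowerLetter3_of_arc_discSplit`) — `A := (1 + 1∕5)·(11∕10·L⁻¹)²` (`κ := 1∕5`; `A·L = 363∕(250·L) ≤ ½` for `3 ≤ L`, the only block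
  sizes of a `T3Family`; `L = 2` is vacuous by `F.hL.1`), `c := fun u => if hu : u < K − J then (1 + (1∕5)⁻¹)·D′lam u hu else 0` (px20's letter-free discrepancy energy
  `D′`, one λ for all levels, internal height `K − (J + (u+1))` substituted — kernel-identical to `topRow'`'s RHS at `u = 0` and to `liftRow'`'s source at `u = t+1`),
  `σ := 1∕4`, `α₀ := min α₀ᴬ α₀ᴰ`, `β := 6(q + β_X)`, `C_c := 6C_X`, `c_c := c_X`.
THE TWO HYPOTHESES (each a LETTER in the station's own ⁗ prefix — sup window, (E5) Σ-window, (E3) datum guard `G F J (descendTo U₀)`, (BKG), (E4) fibre mate — with the 17 `AxStage`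
clauses as explicit binders):
* `hARC` — the ARC PROFILE of the two gauged stage towers at every internal height `1 ≤ i < K − J` (arcs `≤ 1∕4`), θ-GENERIC and G-INDEXED.  Supplier of record: px12's
  ✓`…GuardLettersTheta.arcProfile_theta_axStage` (θ-generic; needs the DATUM's small-bond conjunct `arc(V e) ≤ 1∕128` — available from `G` via (E3) exactly when `G`
  carries it: D-GUARD's one visible binder for the strata guards of knit v6 — and a Σθ-window; see the HONEST paragraph).
* `hDBX` — the SPLIT D′-BUDGET: per datum `∃ X : ℕ → ℝ` with (SPLIT) `D′lam t ≤ X t + q·E′lam t` (`t < K − J`; child-level feedback) and (SRC′) `Σ_{t<K−J} L^t·X t ≤ C_X·e^{c_X·Σθ}·purse + β_X·S′`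
  (the source budget's own feedback share, ARCHITECT RULING «β_X» 21:37:14Z (b): parent-currency feedback — the face row's central-bond lift, the c₁ core's `β₁·S′` — rides in `X`),
  constants `0 ≤ q`, `0 ≤ β_X`, `(1 + 5)·(q + β_X) ≤ 1∕4`, `C_X, c_X ≥ 0` before the member — the two hypotheses of px21 g25's ✓`hSCT_of_discSplit'` ((iii) ed. 1.1), which
  turns them into the station's `hSCT_fb` with `C_c := 6·C_X`, `c_c := c_X`, `β := 6(q + β_X)` (`κ = 1∕5`).  `X` is ABSTRACT (no supplier text frozen): suppliers of record px10 g26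
  `…CurlBudget` (c₁ core), px5∕px20 (face row c₃: ✓p835106 ∕ ✓p834378 — the `mR²` part is the `q·E′` feedback), px12 ((RSP-Σ) ✓p833422∕✓p834939), (BKG).
Successor editions replace `hDBX` by the named source letters as their bytes land (append-only new files, never an edit).

HONEST SCOPE.  Composition BY NAME over landed theorems plus real-number bookkeeping; BOTH hypotheses are HYPOTHESES (un-discharged letters).  Located, not hidden:
(i) the (E5) Σ-window is a SUPPLIER-SIDE guard, discharged at `θ := θBal` by ✓`thresholdSum_small` inside the final consumer (RULING №112 C3: never in a registered
text); with it px12's θ-generic letters (✓p834939, ✓p835602) dock into `hARC`∕`hDBX`'s suppliers directly; (ii) the datum small-bond conjunct is NOT suppliable as a `∀ J` letter at coarse `J` (toron obstruction, UV3-NODE §90) — D-GUARD.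
Nothing of Bałaban's renormalisation-group analysis is asserted or proved ([Balaban1985Averaging] Prop. 4 (128)–(135) pp.37–38 is the printed sup recursion these
letters transcribe; [Balaban1985RegularSpaces] (1.19) p.79, (1.29) p.81; [Balaban1987RG1] (0.4), (0.11) p.253); (ST‴), LOC‴, AVG₂, (D-stage)×2, h3 are HYPOTHESES of
the chain; GAP♯∘ (`stub_uniformFibreGapOrbit`), the five registered stubs (0∕5), S2β, crux 20520, 19936, 19200 and `YM3TorusSU2` are NOT proved; no registered stub is
closed; the Yang–Mills mass gap is NOT proved.  Axioms standard.
-/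

set_option autoImplicit false

noncomputable section

open scoped Matrix.Norms.L2Operator Topology RealInnerProductSpace
open Set Function
open Literature.MathematicalPhysics.QuantumLattice (su2Quat)
open Literature.MathematicalPhysics.QuantumFieldTheory.Balaban1983to89
open Literature.MathematicalPhysics.QuantumFieldTheory.Balaban1983to89.T3ContinuumYM3Torus
open Literature.MathematicalPhysics.QuantumFieldTheory.Balaban1983to89.T3UnitLawDensityEML (ℰp)
open Literature.MathematicalPhysics.QuantumFieldTheory.Balaban1983to89.T3UnitScaleTilt
open Literature.MathematicalPhysics.QuantumFieldTheory.Balaban1983to89.T3TiltDescent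
open Literature.MathematicalPhysics.QuantumFieldTheory.Balaban1983to89.T3LevelShift
open Literature.MathematicalPhysics.QuantumFieldTheory.Balaban1983to89.ExpMeanLog (deltaSU)
open Literature.MathematicalPhysics.QuantumFieldTheory.Balaban1983to89.T4HaarSU2ExpChart (expPoint)
open Literature.MathematicalPhysics.QuantumFieldTheory.Balaban1983to89.T4ExpWindowSmallField (logVec)
open Literature.MathematicalPhysics.QuantumFieldTheory.Balaban1983to89.T4Continuum
open Literature.MathematicalPhysics.QuantumFieldTheory.Balaban1983to89.T3DescentFibreTower
open Literature.MathematicalPhysics.QuantumFieldTheory.Balaban1983to89.B10Eq27TorusAxialLog (rel axialT)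
open Literature.MathematicalPhysics.QuantumFieldTheory.Balaban1983to89.T4CubeChartGnomonic (SU2)
open Literature.MathematicalPhysics.QuantumFieldTheory.Balaban1983to89.BlockAveraging (blockAvg)
open Summit.QuantumFields.YangMills.Theorems.FluctuationComparisonRegPrIntLS2BetaSupTowerOfLiftLadderNestedSigma (supTowerLetter_of_liftLadderFbLetter'''')
open Summit.QuantumFields.YangMills.Theorems.FluctuationComparisonRegPrIntLS2BetaLiftLadderRowsDock (rows_dock)
open Summit.QuantumFields.YangMills.Theorems.FluctuationComparisonRegPrIntLS2BetaLiftLadderDiscBudgetSplit (hSCT_of_discSplit')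

namespace Summit.QuantumFields.YangMills.Theorems.FluctuationComparisonRegPrIntLS2BetaSupTowerLetterOfSuppliersAt

set_option maxHeartbeats 400000 in
/-- ★★★ **THE SUPPLIER KNIT, PER-GUARD EDITION: at a fixed guard `G`, `hSTL⁗ G` (the (ST‴) text + the (E5) Σ-window guard) FROM THE ARC-PROFILE LETTER AT `G` AND THE SPLIT D′-BUDGET LETTER AT `G`** (RULING №64; ✓p836564's statement with `G` moved out of the three `∀ G` binders;
letters receive the same guard line, so they are WEAKER than the ‴ letters — px12's Σ-window editions dock directly) — the station 3⁗ `…NestedSigma` §1 at `Ax := AxStage` with its constants EXHIBITED (`A := (6∕5)·(11∕10·L⁻¹)²`, `c := (1+5)·D′lam` on `t < K − J`, `σ := ¼`, `κ := 1∕5`,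
`α₀ := min`, `β := 6(q+β_X)`, `C_c := 6C_X`, `c_c := c_X`), its rows `hTOP`∕`hREC` discharged through ✓`rows_dock` (px21 g25) over px20's ✓`topRow'`∕✓`liftRow'`,
and its budget `hSCT_fb` through ✓`hSCT_of_discSplit'` (px21 g25) from the per-datum split `D′ ≤ X + q·E′` and the source budget of `X` (with its `β_X·S′` share).
[cite: Balaban1985Averaging, Prop. 4 (128)-(135) pp.37-38; Balaban1985RegularSpaces, (1.19) p.79, (1.29) p.81; Balaban1987RG1, (0.4), (0.11) p.253] -/
theorem supTowerLetter4_at (G : (F : T3Family) → (J : ℕ) → GaugeField (F.P J) 0 (Matrix.specialUnitaryGroup (Fin 2) ℂ) → Prop)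
    (hARC :
      ∀ (L : ℕ), 1 < L → ∀ (C_B : ℝ), 0 ≤ C_B → ∃ α₀ : ℝ, 0 < α₀ ∧ ∀ (F : T3Family), F.L = L →
      ∀ (J K : ℕ) (hJK : J ≤ K) (θ : ℕ → ℝ), (∀ i, 0 ≤ θ i) → ∀ (α : ℝ), (∀ i, J < i → i ≤ K → (((5 * F.L : ℕ) : ℝ) ^ 2 / 4) * θ i ≤ α) →
        (∑ i ∈ Finset.range (K - J), (((5 * F.L : ℕ) : ℝ) ^ 2 / 4) * θ (K - i)) ≤ α →
        α ≤ 1 / 24 → α < deltaSU (Fin 2) → 157 * α < ((F.L : ℝ) ^ 2)⁻¹ → α ≤ α₀ →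
        ∀ U₀ : GaugeField (F.P K) 0 (Matrix.specialUnitaryGroup (Fin 2) ℂ), U₀ ∈ histGood F ℰp θ K J →
        G F J (descendTo F ℰp J K hJK U₀) →
        (∀ t, t ≤ K - J → ∀ p : Plaq (F.P K) t,
          dist1 (GaugeField.plaqHol (Averaging.iter (fun k => BlockAveraging.blockAvg (P := F.P K) (j := k) ℰp) t U₀) p) ≤
            C_B * α * (F.L : ℝ) ^ (2 * t) * ((F.L : ℝ)⁻¹) ^ (2 * (K - J))) →
        ∀ ζ : PBond (F.P K) 0 → EuclideanSpace ℝ (Fin 3), (∀ ℓ, ‖ζ ℓ‖ ≤ Real.pi) →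
          (fun ℓ => expPoint (ζ ℓ) * U₀ ℓ : GaugeField (F.P K) 0 (Matrix.specialUnitaryGroup (Fin 2) ℂ)) ∈ histGood F ℰp θ K J →
            descendTo F ℰp J K hJK (fun ℓ => expPoint (ζ ℓ) * U₀ ℓ : GaugeField (F.P K) 0 (Matrix.specialUnitaryGroup (Fin 2) ℂ)) = descendTo F ℰp J K hJK U₀ →
            ∀ (wt : (j : ℕ) → PBond (F.P K) j → PBond (F.P K) (j + 1) → ℝ)
            (lift : (j : ℕ) → GaugeField (F.P K) (j + 1) SU2 → GaugeField (F.P K) j SU2)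
            (U₁ : GaugeField (F.P K) 0 SU2) (g g₀ : (j : ℕ) → Site (F.P K) j → SU2),
          (∀ j b e, wt j b e = if e.dir = b.dir ∧ (b.src b.dir - emb e.src b.dir).val < (F.P K).L then
              ∏ ν ∈ Finset.univ.erase b.dir, max 0 (1 - ((rel (emb e.src) b.src ν).natAbs : ℝ) / (F.P K).L) else 0) →
          (∀ j X b, lift j X b = expPoint (∑ e, wt j b e • ((((F.P K).L : ℕ) : ℝ)⁻¹ • logVec (su2Quat (X e))))) →
          (∀ j, j < K - J → ∀ x, g j x =
            (axialT (lift j (GaugeField.gaugeAct (g (j + 1)) (Averaging.iter (fun k => blockAvg (P := F.P K) (j := k) ℰp) (j + 1) (fun ℓ => expPoint (ζ ℓ) * U₀ ℓ))))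
                (emb (blockOf x)) x)⁻¹ *
              g (j + 1) (blockOf x) * axialT (Averaging.iter (fun k => blockAvg (P := F.P K) (j := k) ℰp) j (fun ℓ => expPoint (ζ ℓ) * U₀ ℓ)) (emb (blockOf x)) x) →
          (∀ j, K - J ≤ j → ∀ y, g j y = 1) →
          (∀ j, j < K - J → ∀ y : Site (F.P K) (j + 1), g j (emb y) = g (j + 1) y) →
          (∀ X : GaugeField (F.P K) 0 SU2, ∀ j, j ≤ K - J →
            Averaging.iter (fun k => blockAvg (P := F.P K) (j := k) ℰp) j (GaugeField.gaugeAct (g 0) X) =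
              GaugeField.gaugeAct (g j) (Averaging.iter (fun k => blockAvg (P := F.P K) (j := k) ℰp) j X)) →
          (∀ j, j < K - J → ∀ x,
            axialT (GaugeField.gaugeAct (g j) (Averaging.iter (fun k => blockAvg (P := F.P K) (j := k) ℰp) j (fun ℓ => expPoint (ζ ℓ) * U₀ ℓ))) (emb (blockOf x)) x =
              axialT (lift j (GaugeField.gaugeAct (g (j + 1)) (Averaging.iter (fun k => blockAvg (P := F.P K) (j := k) ℰp) (j + 1) (fun ℓ => expPoint (ζ ℓ) * U₀ ℓ))))
                (emb (blockOf x)) x) →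
          (∀ j, j < K - J →
            (blockAvg (P := F.P K) (j := j) ℰp).avg (GaugeField.gaugeAct (g j) (Averaging.iter (fun k => blockAvg (P := F.P K) (j := k) ℰp) j (fun ℓ => expPoint (ζ ℓ) * U₀ ℓ))) =
              GaugeField.gaugeAct (g (j + 1)) (Averaging.iter (fun k => blockAvg (P := F.P K) (j := k) ℰp) (j + 1) (fun ℓ => expPoint (ζ ℓ) * U₀ ℓ))) →
          (∀ j, j < K - J → ∀ x, g₀ j x =
            (axialT (lift j (GaugeField.gaugeAct (g₀ (j + 1)) (Averaging.iter (fun k => blockAvg (P := F.P K) (j := k) ℰp) (j + 1) U₁)))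
                (emb (blockOf x)) x)⁻¹ *
              g₀ (j + 1) (blockOf x) * axialT (Averaging.iter (fun k => blockAvg (P := F.P K) (j := k) ℰp) j U₁) (emb (blockOf x)) x) →
          (∀ j, K - J ≤ j → ∀ y, g₀ j y = 1) →
          (∀ j, j < K - J → ∀ y : Site (F.P K) (j + 1), g₀ j (emb y) = g₀ (j + 1) y) →
          (∀ X : GaugeField (F.P K) 0 SU2, ∀ j, j ≤ K - J →
            Averaging.iter (fun k => blockAvg (P := F.P K) (j := k) ℰp) j (GaugeField.gaugeAct (g₀ 0) X) =
              GaugeField.gaugeAct (g₀ j) (Averaging.iter (fun k => blockAvg (P := F.P K) (j := k) ℰp) j X)) →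
          (∀ j, j < K - J → ∀ x,
            axialT (GaugeField.gaugeAct (g₀ j) (Averaging.iter (fun k => blockAvg (P := F.P K) (j := k) ℰp) j U₁)) (emb (blockOf x)) x =
              axialT (lift j (GaugeField.gaugeAct (g₀ (j + 1)) (Averaging.iter (fun k => blockAvg (P := F.P K) (j := k) ℰp) (j + 1) U₁)))
                (emb (blockOf x)) x) →
          (∀ j, j < K - J →
            (blockAvg (P := F.P K) (j := j) ℰp).avg (GaugeField.gaugeAct (g₀ j) (Averaging.iter (fun k => blockAvg (P := F.P K) (j := k) ℰp) j U₁)) =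
              GaugeField.gaugeAct (g₀ (j + 1)) (Averaging.iter (fun k => blockAvg (P := F.P K) (j := k) ℰp) (j + 1) U₁)) →
          (∀ X : GaugeField (F.P K) 0 SU2, Averaging.iter (fun k => blockAvg (P := F.P K) (j := k) ℰp) (K - J) (GaugeField.gaugeAct (fun x => (g 0 x)⁻¹) X) = Averaging.iter (fun k => blockAvg (P := F.P K) (j := k) ℰp) (K - J) X) →
          (∀ X : GaugeField (F.P K) 0 SU2, Averaging.iter (fun k => blockAvg (P := F.P K) (j := k) ℰp) (K - J) (GaugeField.gaugeAct (g₀ 0) X) = Averaging.iter (fun k => blockAvg (P := F.P K) (j := k) ℰp) (K - J) X) →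
          U₀ = GaugeField.gaugeAct (fun x => (g 0 x)⁻¹ * g₀ 0 x) U₁ →

                      ∀ i, 1 ≤ i → i < K - J → ∀ e : PBond (F.P K) i,
            ‖logVec (su2Quat (GaugeField.gaugeAct (g i) (Averaging.iter (fun k => blockAvg (P := F.P K) (j := k) ℰp) i (fun ℓ => expPoint (ζ ℓ) * U₀ ℓ)) e))‖ ≤ 1 / 4 ∧
            ‖logVec (su2Quat (GaugeField.gaugeAct (g₀ i) (Averaging.iter (fun k => blockAvg (P := F.P K) (j := k) ℰp) i U₁) e))‖ ≤ 1 / 4)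
    (hDBX :
      ∀ (L : ℕ), 1 < L → ∀ (C_B : ℝ), 0 ≤ C_B → ∃ α₀ : ℝ, 0 < α₀ ∧ ∃ q : ℝ, 0 ≤ q ∧ ∃ β_X : ℝ, 0 ≤ β_X ∧ (1 + (1 / 5 : ℝ)⁻¹) * (q + β_X) ≤ 1 / 4 ∧ ∃ C_X : ℝ, 0 ≤ C_X ∧ ∃ c_X : ℝ, 0 ≤ c_X ∧ ∀ (F : T3Family), F.L = L →
      ∀ (J K : ℕ) (hJK : J ≤ K) (θ : ℕ → ℝ), (∀ i, 0 ≤ θ i) → ∀ (α : ℝ), (∀ i, J < i → i ≤ K → (((5 * F.L : ℕ) : ℝ) ^ 2 / 4) * θ i ≤ α) →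
        (∑ i ∈ Finset.range (K - J), (((5 * F.L : ℕ) : ℝ) ^ 2 / 4) * θ (K - i)) ≤ α →
        α ≤ 1 / 24 → α < deltaSU (Fin 2) → 157 * α < ((F.L : ℝ) ^ 2)⁻¹ → α ≤ α₀ →
        ∀ U₀ : GaugeField (F.P K) 0 (Matrix.specialUnitaryGroup (Fin 2) ℂ), U₀ ∈ histGood F ℰp θ K J →
        G F J (descendTo F ℰp J K hJK U₀) →
        (∀ t, t ≤ K - J → ∀ p : Plaq (F.P K) t,
          dist1 (GaugeField.plaqHol (Averaging.iter (fun k => BlockAveraging.blockAvg (P := F.P K) (j := k) ℰp) t U₀) p) ≤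
            C_B * α * (F.L : ℝ) ^ (2 * t) * ((F.L : ℝ)⁻¹) ^ (2 * (K - J))) →
        ∀ ζ : PBond (F.P K) 0 → EuclideanSpace ℝ (Fin 3), (∀ ℓ, ‖ζ ℓ‖ ≤ Real.pi) →
          (fun ℓ => expPoint (ζ ℓ) * U₀ ℓ : GaugeField (F.P K) 0 (Matrix.specialUnitaryGroup (Fin 2) ℂ)) ∈ histGood F ℰp θ K J →
            descendTo F ℰp J K hJK (fun ℓ => expPoint (ζ ℓ) * U₀ ℓ : GaugeField (F.P K) 0 (Matrix.specialUnitaryGroup (Fin 2) ℂ)) = descendTo F ℰp J K hJK U₀ →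
            ∀ (wt : (j : ℕ) → PBond (F.P K) j → PBond (F.P K) (j + 1) → ℝ)
            (lift : (j : ℕ) → GaugeField (F.P K) (j + 1) SU2 → GaugeField (F.P K) j SU2)
            (U₁ : GaugeField (F.P K) 0 SU2) (g g₀ : (j : ℕ) → Site (F.P K) j → SU2),
          (∀ j b e, wt j b e = if e.dir = b.dir ∧ (b.src b.dir - emb e.src b.dir).val < (F.P K).L then
              ∏ ν ∈ Finset.univ.erase b.dir, max 0 (1 - ((rel (emb e.src) b.src ν).natAbs : ℝ) / (F.P K).L) else 0) →
          (∀ j X b, lift j X b = expPoint (∑ e, wt j b e • ((((F.P K).L : ℕ) : ℝ)⁻¹ • logVec (su2Quat (X e))))) →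
          (∀ j, j < K - J → ∀ x, g j x =
            (axialT (lift j (GaugeField.gaugeAct (g (j + 1)) (Averaging.iter (fun k => blockAvg (P := F.P K) (j := k) ℰp) (j + 1) (fun ℓ => expPoint (ζ ℓ) * U₀ ℓ))))
                (emb (blockOf x)) x)⁻¹ *
              g (j + 1) (blockOf x) * axialT (Averaging.iter (fun k => blockAvg (P := F.P K) (j := k) ℰp) j (fun ℓ => expPoint (ζ ℓ) * U₀ ℓ)) (emb (blockOf x)) x) →
          (∀ j, K - J ≤ j → ∀ y, g j y = 1) →
          (∀ j, j < K - J → ∀ y : Site (F.P K) (j + 1), g j (emb y) = g (j + 1) y) →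
          (∀ X : GaugeField (F.P K) 0 SU2, ∀ j, j ≤ K - J →
            Averaging.iter (fun k => blockAvg (P := F.P K) (j := k) ℰp) j (GaugeField.gaugeAct (g 0) X) =
              GaugeField.gaugeAct (g j) (Averaging.iter (fun k => blockAvg (P := F.P K) (j := k) ℰp) j X)) →
          (∀ j, j < K - J → ∀ x,
            axialT (GaugeField.gaugeAct (g j) (Averaging.iter (fun k => blockAvg (P := F.P K) (j := k) ℰp) j (fun ℓ => expPoint (ζ ℓ) * U₀ ℓ))) (emb (blockOf x)) x =
              axialT (lift j (GaugeField.gaugeAct (g (j + 1)) (Averaging.iter (fun k => blockAvg (P := F.P K) (j := k) ℰp) (j + 1) (fun ℓ => expPoint (ζ ℓ) * U₀ ℓ))))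
                (emb (blockOf x)) x) →
          (∀ j, j < K - J →
            (blockAvg (P := F.P K) (j := j) ℰp).avg (GaugeField.gaugeAct (g j) (Averaging.iter (fun k => blockAvg (P := F.P K) (j := k) ℰp) j (fun ℓ => expPoint (ζ ℓ) * U₀ ℓ))) =
              GaugeField.gaugeAct (g (j + 1)) (Averaging.iter (fun k => blockAvg (P := F.P K) (j := k) ℰp) (j + 1) (fun ℓ => expPoint (ζ ℓ) * U₀ ℓ))) →
          (∀ j, j < K - J → ∀ x, g₀ j x =
            (axialT (lift j (GaugeField.gaugeAct (g₀ (j + 1)) (Averaging.iter (fun k => blockAvg (P := F.P K) (j := k) ℰp) (j + 1) U₁)))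
                (emb (blockOf x)) x)⁻¹ *
              g₀ (j + 1) (blockOf x) * axialT (Averaging.iter (fun k => blockAvg (P := F.P K) (j := k) ℰp) j U₁) (emb (blockOf x)) x) →
          (∀ j, K - J ≤ j → ∀ y, g₀ j y = 1) →
          (∀ j, j < K - J → ∀ y : Site (F.P K) (j + 1), g₀ j (emb y) = g₀ (j + 1) y) →
          (∀ X : GaugeField (F.P K) 0 SU2, ∀ j, j ≤ K - J →
            Averaging.iter (fun k => blockAvg (P := F.P K) (j := k) ℰp) j (GaugeField.gaugeAct (g₀ 0) X) =
              GaugeField.gaugeAct (g₀ j) (Averaging.iter (fun k => blockAvg (P := F.P K) (j := k) ℰp) j X)) →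
          (∀ j, j < K - J → ∀ x,
            axialT (GaugeField.gaugeAct (g₀ j) (Averaging.iter (fun k => blockAvg (P := F.P K) (j := k) ℰp) j U₁)) (emb (blockOf x)) x =
              axialT (lift j (GaugeField.gaugeAct (g₀ (j + 1)) (Averaging.iter (fun k => blockAvg (P := F.P K) (j := k) ℰp) (j + 1) U₁)))
                (emb (blockOf x)) x) →
          (∀ j, j < K - J →
            (blockAvg (P := F.P K) (j := j) ℰp).avg (GaugeField.gaugeAct (g₀ j) (Averaging.iter (fun k => blockAvg (P := F.P K) (j := k) ℰp) j U₁)) =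
              GaugeField.gaugeAct (g₀ (j + 1)) (Averaging.iter (fun k => blockAvg (P := F.P K) (j := k) ℰp) (j + 1) U₁)) →
          (∀ X : GaugeField (F.P K) 0 SU2, Averaging.iter (fun k => blockAvg (P := F.P K) (j := k) ℰp) (K - J) (GaugeField.gaugeAct (fun x => (g 0 x)⁻¹) X) = Averaging.iter (fun k => blockAvg (P := F.P K) (j := k) ℰp) (K - J) X) →
          (∀ X : GaugeField (F.P K) 0 SU2, Averaging.iter (fun k => blockAvg (P := F.P K) (j := k) ℰp) (K - J) (GaugeField.gaugeAct (g₀ 0) X) = Averaging.iter (fun k => blockAvg (P := F.P K) (j := k) ℰp) (K - J) X) →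
          U₀ = GaugeField.gaugeAct (fun x => (g 0 x)⁻¹ * g₀ 0 x) U₁ →

                      ∃ X : ℕ → ℝ,
            (∀ (t : ℕ) (ht : t < K - J), (fun (u : ℕ) (hu : u < K - J) => ∑ B : PBond (F.P J) 0,
            ‖(fun ℓ' : PBond (F.P (J + (u + 1))) 0 =>
              if (∃ z : Site (F.P (J + (u + 1))) 0,
                (B14.Eq22Determines.blockIter (u + 1) z = (bondShift (F.sitesPerDir_eq (m := F.m) (K := J) (j := 0) (m' := F.m) (K' := J + (u + 1)) (j' := u + 1) (by omega)) B).src ∨ B14.Eq22Determines.blockIter (u + 1) z = (bondShift (F.sitesPerDir_eq (m := F.m) (K := J) (j := 0) (m' := F.m) (K' := J + (u + 1)) (j' := u + 1) (by omega)) B).tgt) ∧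
                ∀ ν, (B10Eq27TorusAxialLog.rel z ℓ'.src ν).natAbs ≤ 2) ∧
                ¬ (blockOf (ℓ'.src.shift ℓ'.dir) = blockOf ℓ'.src ∧ ∀ ν, ν < ℓ'.dir → B10Eq27TorusAxialLog.rel (emb (blockOf ℓ'.src)) ℓ'.src ν = 0)
              then logVec (su2Quat ((lift (K - (J + (u + 1))) (GaugeField.gaugeAct (g ((K - (J + (u + 1))) + 1)) (Averaging.iter (fun k => blockAvg (P := F.P K) (j := k) ℰp) ((K - (J + (u + 1))) + 1) (fun ℓ => expPoint (ζ ℓ) * U₀ ℓ))) (bondShift (F.sitesPerDir_eq (m := F.m) (K := J + (u + 1)) (j := 0) (m' := F.m) (K' := K) (j' := (K - (J + (u + 1)))) (by omega)) ℓ') *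
                    (lift (K - (J + (u + 1))) (GaugeField.gaugeAct (g₀ ((K - (J + (u + 1))) + 1)) (Averaging.iter (fun k => blockAvg (P := F.P K) (j := k) ℰp) ((K - (J + (u + 1))) + 1) U₁)) (bondShift (F.sitesPerDir_eq (m := F.m) (K := J + (u + 1)) (j := 0) (m' := F.m) (K' := K) (j' := (K - (J + (u + 1)))) (by omega)) ℓ'))⁻¹)⁻¹ *
                  (GaugeField.gaugeAct (g (K - (J + (u + 1)))) (Averaging.iter (fun k => blockAvg (P := F.P K) (j := k) ℰp) (K - (J + (u + 1))) (fun ℓ => expPoint (ζ ℓ) * U₀ ℓ)) (bondShift (F.sitesPerDir_eq (m := F.m) (K := J + (u + 1)) (j := 0) (m' := F.m) (K' := K) (j' := (K - (J + (u + 1)))) (by omega)) ℓ') *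
                    (GaugeField.gaugeAct (g₀ (K - (J + (u + 1)))) (Averaging.iter (fun k => blockAvg (P := F.P K) (j := k) ℰp) (K - (J + (u + 1))) U₁) (bondShift (F.sitesPerDir_eq (m := F.m) (K := J + (u + 1)) (j := 0) (m' := F.m) (K' := K) (j' := (K - (J + (u + 1)))) (by omega)) ℓ'))⁻¹))) else 0)‖ ^ 2) t ht ≤ X t + q * (fun (t : ℕ) (ht : t < K - J) => ∑ B : PBond (F.P J) 0,
            ‖(fun ℓ' : PBond (F.P (J + (t + 1))) 0 =>
              if ∃ z : Site (F.P (J + (t + 1))) 0,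
                (B14.Eq22Determines.blockIter (t + 1) z = (bondShift (F.sitesPerDir_eq (m := F.m) (K := J) (j := 0) (m' := F.m) (K' := J + (t + 1)) (j' := t + 1) (by omega)) B).src ∨ B14.Eq22Determines.blockIter (t + 1) z = (bondShift (F.sitesPerDir_eq (m := F.m) (K := J) (j := 0) (m' := F.m) (K' := J + (t + 1)) (j' := t + 1) (by omega)) B).tgt) ∧
                ∀ ν, (B10Eq27TorusAxialLog.rel z ℓ'.src ν).natAbs ≤ 2
              then logVec (su2Quat (descendTo F ℰp (J + (t + 1)) K (by omega) (fun ℓ => expPoint (ζ ℓ) * U₀ ℓ : GaugeField (F.P K) 0 (Matrix.specialUnitaryGroup (Fin 2) ℂ)) ℓ' * (descendTo F ℰp (J + (t + 1)) K (by omega) U₀ ℓ')⁻¹)) else 0)‖ ^ 2) t ht) ∧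
            ∑ t ∈ Finset.range (K - J), (F.L : ℝ) ^ t * X t ≤ C_X * Real.exp (c_X * ∑ i ∈ Finset.range (K - J), (((5 * F.L : ℕ) : ℝ) ^ 2 / 4) * θ (K - i)) * (((F.L : ℝ)⁻¹) ^ (K - J) * ∑ ℓ : PBond (F.P K) 0, ‖ζ ℓ‖ ^ 2 +
                (F.L : ℝ) ^ (K - J) * ∑ p : Plaq (F.P K) 0,
                  (1 - reTr ((GaugeField.plaqHol U₀ p)⁻¹ * GaugeField.plaqHol (fun ℓ => expPoint (ζ ℓ) * U₀ ℓ : GaugeField (F.P K) 0 (Matrix.specialUnitaryGroup (Fin 2) ℂ)) p))) +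
              β_X * (∑ t ∈ Finset.range (K - J), (if ht : t < K - J then
          (F.L : ℝ) ^ t * ∑ B : PBond (F.P J) 0,
            ‖(fun ℓ' : PBond (F.P (J + (t + 1))) 0 =>
              if ∃ z : Site (F.P (J + (t + 1))) 0,
                (B14.Eq22Determines.blockIter (t + 1) z = (bondShift (F.sitesPerDir_eq (m := F.m) (K := J) (j := 0) (m' := F.m) (K' := J + (t + 1)) (j' := t + 1) (by omega)) B).src ∨ B14.Eq22Determines.blockIter (t + 1) z = (bondShift (F.sitesPerDir_eq (m := F.m) (K := J) (j := 0) (m' := F.m) (K' := J + (t + 1)) (j' := t + 1) (by omega)) B).tgt) ∧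
                ∀ ν, (B10Eq27TorusAxialLog.rel z ℓ'.src ν).natAbs ≤ 2
              then logVec (su2Quat (descendTo F ℰp (J + (t + 1)) K (by omega) (fun ℓ => expPoint (ζ ℓ) * U₀ ℓ : GaugeField (F.P K) 0 (Matrix.specialUnitaryGroup (Fin 2) ℂ)) ℓ' * (descendTo F ℰp (J + (t + 1)) K (by omega) U₀ ℓ')⁻¹)) else 0)‖ ^ 2
        else 0))) :
         ∀ (L : ℕ), 1 < L → ∀ (C_B : ℝ), 0 ≤ C_B → ∃ α₀ : ℝ, 0 < α₀ ∧ ∃ C_ST : ℝ, 0 ≤ C_ST ∧ ∃ c_ST : ℝ, 0 ≤ c_ST ∧ ∀ (F : T3Family), F.L = L →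
      ∀ (J K : ℕ) (hJK : J ≤ K) (θ : ℕ → ℝ), (∀ i, 0 ≤ θ i) → ∀ (α : ℝ), (∀ i, J < i → i ≤ K → (((5 * F.L : ℕ) : ℝ) ^ 2 / 4) * θ i ≤ α) →
        (∑ i ∈ Finset.range (K - J), (((5 * F.L : ℕ) : ℝ) ^ 2 / 4) * θ (K - i)) ≤ α →
        α ≤ 1 / 24 → α < deltaSU (Fin 2) → 157 * α < ((F.L : ℝ) ^ 2)⁻¹ → α ≤ α₀ →
        ∀ U₀ : GaugeField (F.P K) 0 (Matrix.specialUnitaryGroup (Fin 2) ℂ), U₀ ∈ histGood F ℰp θ K J →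
        G F J (descendTo F ℰp J K hJK U₀) →
        (∀ t, t ≤ K - J → ∀ p : Plaq (F.P K) t,
            dist1 (GaugeField.plaqHol (Averaging.iter (fun k => BlockAveraging.blockAvg (P := F.P K) (j := k) ℰp) t U₀) p) ≤
              C_B * α * (F.L : ℝ) ^ (2 * t) * ((F.L : ℝ)⁻¹) ^ (2 * (K - J))) →
        ∀ ζ : PBond (F.P K) 0 → EuclideanSpace ℝ (Fin 3), (∀ ℓ, ‖ζ ℓ‖ ≤ Real.pi) →
          (fun ℓ => expPoint (ζ ℓ) * U₀ ℓ : GaugeField (F.P K) 0 (Matrix.specialUnitaryGroup (Fin 2) ℂ)) ∈ histGood F ℰp θ K J →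
          descendTo F ℰp J K hJK (fun ℓ => expPoint (ζ ℓ) * U₀ ℓ : GaugeField (F.P K) 0 (Matrix.specialUnitaryGroup (Fin 2) ℂ)) = descendTo F ℰp J K hJK U₀ →
          (∃ (wt : (j : ℕ) → PBond (F.P K) j → PBond (F.P K) (j + 1) → ℝ)
            (lift : (j : ℕ) → GaugeField (F.P K) (j + 1) SU2 → GaugeField (F.P K) j SU2)
            (U₁ : GaugeField (F.P K) 0 SU2) (g g₀ : (j : ℕ) → Site (F.P K) j → SU2),
          (∀ j b e, wt j b e = if e.dir = b.dir ∧ (b.src b.dir - emb e.src b.dir).val < (F.P K).L then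
              ∏ ν ∈ Finset.univ.erase b.dir, max 0 (1 - ((rel (emb e.src) b.src ν).natAbs : ℝ) / (F.P K).L) else 0) ∧
          (∀ j X b, lift j X b = expPoint (∑ e, wt j b e • ((((F.P K).L : ℕ) : ℝ)⁻¹ • logVec (su2Quat (X e))))) ∧
          (∀ j, j < K - J → ∀ x, g j x =
            (axialT (lift j (GaugeField.gaugeAct (g (j + 1)) (Averaging.iter (fun k => blockAvg (P := F.P K) (j := k) ℰp) (j + 1) (fun ℓ => expPoint (ζ ℓ) * U₀ ℓ))))
                (emb (blockOf x)) x)⁻¹ *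
              g (j + 1) (blockOf x) * axialT (Averaging.iter (fun k => blockAvg (P := F.P K) (j := k) ℰp) j (fun ℓ => expPoint (ζ ℓ) * U₀ ℓ)) (emb (blockOf x)) x) ∧
          (∀ j, K - J ≤ j → ∀ y, g j y = 1) ∧
          (∀ j, j < K - J → ∀ y : Site (F.P K) (j + 1), g j (emb y) = g (j + 1) y) ∧
          (∀ X : GaugeField (F.P K) 0 SU2, ∀ j, j ≤ K - J →
            Averaging.iter (fun k => blockAvg (P := F.P K) (j := k) ℰp) j (GaugeField.gaugeAct (g 0) X) =
              GaugeField.gaugeAct (g j) (Averaging.iter (fun k => blockAvg (P := F.P K) (j := k) ℰp) j X)) ∧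
          (∀ j, j < K - J → ∀ x,
            axialT (GaugeField.gaugeAct (g j) (Averaging.iter (fun k => blockAvg (P := F.P K) (j := k) ℰp) j (fun ℓ => expPoint (ζ ℓ) * U₀ ℓ))) (emb (blockOf x)) x =
              axialT (lift j (GaugeField.gaugeAct (g (j + 1)) (Averaging.iter (fun k => blockAvg (P := F.P K) (j := k) ℰp) (j + 1) (fun ℓ => expPoint (ζ ℓ) * U₀ ℓ))))
                (emb (blockOf x)) x) ∧
          (∀ j, j < K - J →
            (blockAvg (P := F.P K) (j := j) ℰp).avg (GaugeField.gaugeAct (g j) (Averaging.iter (fun k => blockAvg (P := F.P K) (j := k) ℰp) j (fun ℓ => expPoint (ζ ℓ) * U₀ ℓ))) =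
              GaugeField.gaugeAct (g (j + 1)) (Averaging.iter (fun k => blockAvg (P := F.P K) (j := k) ℰp) (j + 1) (fun ℓ => expPoint (ζ ℓ) * U₀ ℓ))) ∧
          (∀ j, j < K - J → ∀ x, g₀ j x =
            (axialT (lift j (GaugeField.gaugeAct (g₀ (j + 1)) (Averaging.iter (fun k => blockAvg (P := F.P K) (j := k) ℰp) (j + 1) U₁)))
                (emb (blockOf x)) x)⁻¹ *
              g₀ (j + 1) (blockOf x) * axialT (Averaging.iter (fun k => blockAvg (P := F.P K) (j := k) ℰp) j U₁) (emb (blockOf x)) x) ∧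
          (∀ j, K - J ≤ j → ∀ y, g₀ j y = 1) ∧
          (∀ j, j < K - J → ∀ y : Site (F.P K) (j + 1), g₀ j (emb y) = g₀ (j + 1) y) ∧
          (∀ X : GaugeField (F.P K) 0 SU2, ∀ j, j ≤ K - J →
            Averaging.iter (fun k => blockAvg (P := F.P K) (j := k) ℰp) j (GaugeField.gaugeAct (g₀ 0) X) =
              GaugeField.gaugeAct (g₀ j) (Averaging.iter (fun k => blockAvg (P := F.P K) (j := k) ℰp) j X)) ∧
          (∀ j, j < K - J → ∀ x,
            axialT (GaugeField.gaugeAct (g₀ j) (Averaging.iter (fun k => blockAvg (P := F.P K) (j := k) ℰp) j U₁)) (emb (blockOf x)) x =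
              axialT (lift j (GaugeField.gaugeAct (g₀ (j + 1)) (Averaging.iter (fun k => blockAvg (P := F.P K) (j := k) ℰp) (j + 1) U₁)))
                (emb (blockOf x)) x) ∧
          (∀ j, j < K - J →
            (blockAvg (P := F.P K) (j := j) ℰp).avg (GaugeField.gaugeAct (g₀ j) (Averaging.iter (fun k => blockAvg (P := F.P K) (j := k) ℰp) j U₁)) =
              GaugeField.gaugeAct (g₀ (j + 1)) (Averaging.iter (fun k => blockAvg (P := F.P K) (j := k) ℰp) (j + 1) U₁)) ∧
          (∀ X : GaugeField (F.P K) 0 SU2, Averaging.iter (fun k => blockAvg (P := F.P K) (j := k) ℰp) (K - J) (GaugeField.gaugeAct (fun x => (g 0 x)⁻¹) X) = Averaging.iter (fun k => blockAvg (P := F.P K) (j := k) ℰp) (K - J) X) ∧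
          (∀ X : GaugeField (F.P K) 0 SU2, Averaging.iter (fun k => blockAvg (P := F.P K) (j := k) ℰp) (K - J) (GaugeField.gaugeAct (g₀ 0) X) = Averaging.iter (fun k => blockAvg (P := F.P K) (j := k) ℰp) (K - J) X) ∧
          U₀ = GaugeField.gaugeAct (fun x => (g 0 x)⁻¹ * g₀ 0 x) U₁) →
            ∑ t ∈ Finset.range (K - J), (if ht : t < K - J then
          (F.L : ℝ) ^ t * ∑ B : PBond (F.P J) 0,
            ‖(fun ℓ' : PBond (F.P (J + (t + 1))) 0 =>
              if ∃ b : PBond (F.P (J + t)) 0,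
                ((B14.Eq22Determines.blockIter (J + t - J) b.src = (bondShift (F.sitesPerDir_eq (m := F.m) (K := J) (j := 0) (m' := F.m) (K' := J + t) (j' := J + t - J) (by omega)) B).src ∨ B14.Eq22Determines.blockIter (J + t - J) b.src = (bondShift (F.sitesPerDir_eq (m := F.m) (K := J) (j := 0) (m' := F.m) (K' := J + t) (j' := J + t - J) (by omega)) B).tgt) ∧
                (B14.Eq22Determines.blockIter (J + t - J) b.tgt = (bondShift (F.sitesPerDir_eq (m := F.m) (K := J) (j := 0) (m' := F.m) (K' := J + t) (j' := J + t - J) (by omega)) B).src ∨ B14.Eq22Determines.blockIter (J + t - J) b.tgt = (bondShift (F.sitesPerDir_eq (m := F.m) (K := J) (j := 0) (m' := F.m) (K' := J + t) (j' := J + t - J) (by omega)) B).tgt)) ∧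
                (blockOf ℓ'.src = (bondShift (F.sitesPerDir_eq (m := F.m) (K := J + t) (j := 0) (m' := F.m) (K' := J + t + 1) (j' := 1) (by omega)) b).src ∨ blockOf ℓ'.src = (bondShift (F.sitesPerDir_eq (m := F.m) (K := J + t) (j := 0) (m' := F.m) (K' := J + t + 1) (j' := 1) (by omega)) b).tgt)
              then logVec (su2Quat (descendTo F ℰp (J + (t + 1)) K (by omega) (fun ℓ => expPoint (ζ ℓ) * U₀ ℓ : GaugeField (F.P K) 0 (Matrix.specialUnitaryGroup (Fin 2) ℂ)) ℓ' * (descendTo F ℰp (J + (t + 1)) K (by omega) U₀ ℓ')⁻¹)) else 0)‖ ^ 2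
        else 0) ≤
              C_ST * Real.exp (c_ST * ∑ i ∈ Finset.range (K - J), (((5 * F.L : ℕ) : ℝ) ^ 2 / 4) * θ (K - i)) * (((F.L : ℝ)⁻¹) ^ (K - J) * ∑ ℓ : PBond (F.P K) 0, ‖ζ ℓ‖ ^ 2 +
                (F.L : ℝ) ^ (K - J) * ∑ p : Plaq (F.P K) 0,
                  (1 - reTr ((GaugeField.plaqHol U₀ p)⁻¹ * GaugeField.plaqHol (fun ℓ => expPoint (ζ ℓ) * U₀ ℓ : GaugeField (F.P K) 0 (Matrix.specialUnitaryGroup (Fin 2) ℂ)) p))) := by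
  refine supTowerLetter_of_liftLadderFbLetter'''' G
    (fun F J K _ U U₀ =>
          (∃ (wt : (j : ℕ) → PBond (F.P K) j → PBond (F.P K) (j + 1) → ℝ)
            (lift : (j : ℕ) → GaugeField (F.P K) (j + 1) SU2 → GaugeField (F.P K) j SU2)
            (U₁ : GaugeField (F.P K) 0 SU2) (g g₀ : (j : ℕ) → Site (F.P K) j → SU2),
          (∀ j b e, wt j b e = if e.dir = b.dir ∧ (b.src b.dir - emb e.src b.dir).val < (F.P K).L then
              ∏ ν ∈ Finset.univ.erase b.dir, max 0 (1 - ((rel (emb e.src) b.src ν).natAbs : ℝ) / (F.P K).L) else 0) ∧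
          (∀ j X b, lift j X b = expPoint (∑ e, wt j b e • ((((F.P K).L : ℕ) : ℝ)⁻¹ • logVec (su2Quat (X e))))) ∧
          (∀ j, j < K - J → ∀ x, g j x =
            (axialT (lift j (GaugeField.gaugeAct (g (j + 1)) (Averaging.iter (fun k => blockAvg (P := F.P K) (j := k) ℰp) (j + 1) U)))
                (emb (blockOf x)) x)⁻¹ *
              g (j + 1) (blockOf x) * axialT (Averaging.iter (fun k => blockAvg (P := F.P K) (j := k) ℰp) j U) (emb (blockOf x)) x) ∧
          (∀ j, K - J ≤ j → ∀ y, g j y = 1) ∧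
          (∀ j, j < K - J → ∀ y : Site (F.P K) (j + 1), g j (emb y) = g (j + 1) y) ∧
          (∀ X : GaugeField (F.P K) 0 SU2, ∀ j, j ≤ K - J →
            Averaging.iter (fun k => blockAvg (P := F.P K) (j := k) ℰp) j (GaugeField.gaugeAct (g 0) X) =
              GaugeField.gaugeAct (g j) (Averaging.iter (fun k => blockAvg (P := F.P K) (j := k) ℰp) j X)) ∧
          (∀ j, j < K - J → ∀ x,
            axialT (GaugeField.gaugeAct (g j) (Averaging.iter (fun k => blockAvg (P := F.P K) (j := k) ℰp) j U)) (emb (blockOf x)) x =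
              axialT (lift j (GaugeField.gaugeAct (g (j + 1)) (Averaging.iter (fun k => blockAvg (P := F.P K) (j := k) ℰp) (j + 1) U)))
                (emb (blockOf x)) x) ∧
          (∀ j, j < K - J →
            (blockAvg (P := F.P K) (j := j) ℰp).avg (GaugeField.gaugeAct (g j) (Averaging.iter (fun k => blockAvg (P := F.P K) (j := k) ℰp) j U)) =
              GaugeField.gaugeAct (g (j + 1)) (Averaging.iter (fun k => blockAvg (P := F.P K) (j := k) ℰp) (j + 1) U)) ∧
          (∀ j, j < K - J → ∀ x, g₀ j x =
            (axialT (lift j (GaugeField.gaugeAct (g₀ (j + 1)) (Averaging.iter (fun k => blockAvg (P := F.P K) (j := k) ℰp) (j + 1) U₁)))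
                (emb (blockOf x)) x)⁻¹ *
              g₀ (j + 1) (blockOf x) * axialT (Averaging.iter (fun k => blockAvg (P := F.P K) (j := k) ℰp) j U₁) (emb (blockOf x)) x) ∧
          (∀ j, K - J ≤ j → ∀ y, g₀ j y = 1) ∧
          (∀ j, j < K - J → ∀ y : Site (F.P K) (j + 1), g₀ j (emb y) = g₀ (j + 1) y) ∧
          (∀ X : GaugeField (F.P K) 0 SU2, ∀ j, j ≤ K - J →
            Averaging.iter (fun k => blockAvg (P := F.P K) (j := k) ℰp) j (GaugeField.gaugeAct (g₀ 0) X) =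
              GaugeField.gaugeAct (g₀ j) (Averaging.iter (fun k => blockAvg (P := F.P K) (j := k) ℰp) j X)) ∧
          (∀ j, j < K - J → ∀ x,
            axialT (GaugeField.gaugeAct (g₀ j) (Averaging.iter (fun k => blockAvg (P := F.P K) (j := k) ℰp) j U₁)) (emb (blockOf x)) x =
              axialT (lift j (GaugeField.gaugeAct (g₀ (j + 1)) (Averaging.iter (fun k => blockAvg (P := F.P K) (j := k) ℰp) (j + 1) U₁)))
                (emb (blockOf x)) x) ∧
          (∀ j, j < K - J →
            (blockAvg (P := F.P K) (j := j) ℰp).avg (GaugeField.gaugeAct (g₀ j) (Averaging.iter (fun k => blockAvg (P := F.P K) (j := k) ℰp) j U₁)) =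
              GaugeField.gaugeAct (g₀ (j + 1)) (Averaging.iter (fun k => blockAvg (P := F.P K) (j := k) ℰp) (j + 1) U₁)) ∧
          (∀ X : GaugeField (F.P K) 0 SU2, Averaging.iter (fun k => blockAvg (P := F.P K) (j := k) ℰp) (K - J) (GaugeField.gaugeAct (fun x => (g 0 x)⁻¹) X) = Averaging.iter (fun k => blockAvg (P := F.P K) (j := k) ℰp) (K - J) X) ∧
          (∀ X : GaugeField (F.P K) 0 SU2, Averaging.iter (fun k => blockAvg (P := F.P K) (j := k) ℰp) (K - J) (GaugeField.gaugeAct (g₀ 0) X) = Averaging.iter (fun k => blockAvg (P := F.P K) (j := k) ℰp) (K - J) X) ∧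
          U₀ = GaugeField.gaugeAct (fun x => (g 0 x)⁻¹ * g₀ 0 x) U₁)) ?_
  intro L hL C_B hCB
  obtain ⟨α₁, hα₁, HA⟩ := hARC L hL C_B hCB
  obtain ⟨α₂, hα₂, q, hq0, β_X, hβX0, hq4, C_X, hCX, c_X, hcX, HB⟩ := hDBX L hL C_B hCB
  by_cases h3 : 3 ≤ L
  · have hL0 : (0 : ℝ) < (L : ℝ) := by exact_mod_cast (show 0 < L by omega)
    have h3' : (3 : ℝ) ≤ (L : ℝ) := by exact_mod_cast h3
    have hAL : (1 + 1 / 5) * (11 / 10 * (L : ℝ)⁻¹) ^ 2 * (L : ℝ) ≤ 1 / 2 := by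
      rw [show (1 + 1 / 5) * (11 / 10 * (L : ℝ)⁻¹) ^ 2 * (L : ℝ) = (363 / 250) / (L : ℝ) by field_simp; ring]
      rw [div_le_iff₀ hL0]
      linarith
    refine ⟨min α₁ α₂, lt_min hα₁ hα₂, (1 + 1 / 5) * (11 / 10 * (L : ℝ)⁻¹) ^ 2, by positivity, hAL,
      (1 + (1 / 5 : ℝ)⁻¹) * (q + β_X), by positivity, hq4, (1 + (1 / 5 : ℝ)⁻¹) * C_X, by positivity, c_X, hcX, ?_⟩
    intro F hF J K hJK θ hθ α hwin hsw h24 hδ h157 hαm U₀ hU₀g hG hBKG ζ hζ hWg hfib hAx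
    obtain ⟨wt, lift, U₁, g, g₀, hwt, hlift, hgdef, hgtop, hgemb, hT3, hT4, havg, hg₀def, hg₀top, hg₀emb, hT3', hT4', havg₀, hres, hres₀, hU₀⟩ := hAx
    have hL2 : 2 ≤ F.L := F.hL.2
    have harc := HA F hF J K hJK θ hθ α hwin hsw h24 hδ h157 (hαm.trans (min_le_left _ _)) U₀ hU₀g hG hBKG ζ hζ hWg hfib
      wt lift U₁ g g₀ hwt hlift hgdef hgtop hgemb hT3 hT4 havg hg₀def hg₀top hg₀emb hT3' hT4' havg₀ hres hres₀ hU₀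
    obtain ⟨X, hDisc, hX⟩ := HB F hF J K hJK θ hθ α hwin hsw h24 hδ h157 (hαm.trans (min_le_right _ _)) U₀ hU₀g hG hBKG ζ hζ hWg hfib
      wt lift U₁ g g₀ hwt hlift hgdef hgtop hgemb hT3 hT4 havg hg₀def hg₀top hg₀emb hT3' hT4' havg₀ hres hres₀ hU₀
    have hr := rows_dock hJK U₀ ζ wt lift U₁ g g₀ hwt hlift hT3 hT4 hT3' hT4' hU₀ hL2 (σ := 1 / 4) le_rfl harc (κ := 1 / 5) (by norm_num)
      hgtop hg₀top hres hres₀ hfib ((1 + 1 / 5) * (11 / 10 * (L : ℝ)⁻¹) ^ 2)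
      (fun u => if hu : u < K - J then (1 + (1 / 5 : ℝ)⁻¹) * (fun (u : ℕ) (hu : u < K - J) => ∑ B : PBond (F.P J) 0,
            ‖(fun ℓ' : PBond (F.P (J + (u + 1))) 0 =>
              if (∃ z : Site (F.P (J + (u + 1))) 0,
                (B14.Eq22Determines.blockIter (u + 1) z = (bondShift (F.sitesPerDir_eq (m := F.m) (K := J) (j := 0) (m' := F.m) (K' := J + (u + 1)) (j' := u + 1) (by omega)) B).src ∨ B14.Eq22Determines.blockIter (u + 1) z = (bondShift (F.sitesPerDir_eq (m := F.m) (K := J) (j := 0) (m' := F.m) (K' := J + (u + 1)) (j' := u + 1) (by omega)) B).tgt) ∧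
                ∀ ν, (B10Eq27TorusAxialLog.rel z ℓ'.src ν).natAbs ≤ 2) ∧
                ¬ (blockOf (ℓ'.src.shift ℓ'.dir) = blockOf ℓ'.src ∧ ∀ ν, ν < ℓ'.dir → B10Eq27TorusAxialLog.rel (emb (blockOf ℓ'.src)) ℓ'.src ν = 0)
              then logVec (su2Quat ((lift (K - (J + (u + 1))) (GaugeField.gaugeAct (g ((K - (J + (u + 1))) + 1)) (Averaging.iter (fun k => blockAvg (P := F.P K) (j := k) ℰp) ((K - (J + (u + 1))) + 1) (fun ℓ => expPoint (ζ ℓ) * U₀ ℓ))) (bondShift (F.sitesPerDir_eq (m := F.m) (K := J + (u + 1)) (j := 0) (m' := F.m) (K' := K) (j' := (K - (J + (u + 1)))) (by omega)) ℓ') *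
                    (lift (K - (J + (u + 1))) (GaugeField.gaugeAct (g₀ ((K - (J + (u + 1))) + 1)) (Averaging.iter (fun k => blockAvg (P := F.P K) (j := k) ℰp) ((K - (J + (u + 1))) + 1) U₁)) (bondShift (F.sitesPerDir_eq (m := F.m) (K := J + (u + 1)) (j := 0) (m' := F.m) (K' := K) (j' := (K - (J + (u + 1)))) (by omega)) ℓ'))⁻¹)⁻¹ *
                  (GaugeField.gaugeAct (g (K - (J + (u + 1)))) (Averaging.iter (fun k => blockAvg (P := F.P K) (j := k) ℰp) (K - (J + (u + 1))) (fun ℓ => expPoint (ζ ℓ) * U₀ ℓ)) (bondShift (F.sitesPerDir_eq (m := F.m) (K := J + (u + 1)) (j := 0) (m' := F.m) (K' := K) (j' := (K - (J + (u + 1)))) (by omega)) ℓ') *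
                    (GaugeField.gaugeAct (g₀ (K - (J + (u + 1)))) (Averaging.iter (fun k => blockAvg (P := F.P K) (j := k) ℰp) (K - (J + (u + 1))) U₁) (bondShift (F.sitesPerDir_eq (m := F.m) (K := J + (u + 1)) (j := 0) (m' := F.m) (K' := K) (j' := (K - (J + (u + 1)))) (by omega)) ℓ'))⁻¹))) else 0)‖ ^ 2) u hu else 0)
      (by rw [hF]) (fun t ht => by rw [dif_pos ht])
    have hbud := hSCT_of_discSplit' hJK U₀ ζ lift U₁ g g₀ θ (κ := 1 / 5) (by norm_num) X hDisc hX
    -- `c` EXPLICIT (a `_` here costs a higher-order unification `?c 0 =?= …` through the 2 kB λ: 300k heartbeats; explicit: < 200k)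
    exact ⟨fun u => if hu : u < K - J then (1 + (1 / 5 : ℝ)⁻¹) * (fun (u : ℕ) (hu : u < K - J) => ∑ B : PBond (F.P J) 0,
            ‖(fun ℓ' : PBond (F.P (J + (u + 1))) 0 =>
              if (∃ z : Site (F.P (J + (u + 1))) 0,
                (B14.Eq22Determines.blockIter (u + 1) z = (bondShift (F.sitesPerDir_eq (m := F.m) (K := J) (j := 0) (m' := F.m) (K' := J + (u + 1)) (j' := u + 1) (by omega)) B).src ∨ B14.Eq22Determines.blockIter (u + 1) z = (bondShift (F.sitesPerDir_eq (m := F.m) (K := J) (j := 0) (m' := F.m) (K' := J + (u + 1)) (j' := u + 1) (by omega)) B).tgt) ∧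
                ∀ ν, (B10Eq27TorusAxialLog.rel z ℓ'.src ν).natAbs ≤ 2) ∧
                ¬ (blockOf (ℓ'.src.shift ℓ'.dir) = blockOf ℓ'.src ∧ ∀ ν, ν < ℓ'.dir → B10Eq27TorusAxialLog.rel (emb (blockOf ℓ'.src)) ℓ'.src ν = 0)
              then logVec (su2Quat ((lift (K - (J + (u + 1))) (GaugeField.gaugeAct (g ((K - (J + (u + 1))) + 1)) (Averaging.iter (fun k => blockAvg (P := F.P K) (j := k) ℰp) ((K - (J + (u + 1))) + 1) (fun ℓ => expPoint (ζ ℓ) * U₀ ℓ))) (bondShift (F.sitesPerDir_eq (m := F.m) (K := J + (u + 1)) (j := 0) (m' := F.m) (K' := K) (j' := (K - (J + (u + 1)))) (by omega)) ℓ') *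
                    (lift (K - (J + (u + 1))) (GaugeField.gaugeAct (g₀ ((K - (J + (u + 1))) + 1)) (Averaging.iter (fun k => blockAvg (P := F.P K) (j := k) ℰp) ((K - (J + (u + 1))) + 1) U₁)) (bondShift (F.sitesPerDir_eq (m := F.m) (K := J + (u + 1)) (j := 0) (m' := F.m) (K' := K) (j' := (K - (J + (u + 1)))) (by omega)) ℓ'))⁻¹)⁻¹ *
                  (GaugeField.gaugeAct (g (K - (J + (u + 1)))) (Averaging.iter (fun k => blockAvg (P := F.P K) (j := k) ℰp) (K - (J + (u + 1))) (fun ℓ => expPoint (ζ ℓ) * U₀ ℓ)) (bondShift (F.sitesPerDir_eq (m := F.m) (K := J + (u + 1)) (j := 0) (m' := F.m) (K' := K) (j' := (K - (J + (u + 1)))) (by omega)) ℓ') *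
                    (GaugeField.gaugeAct (g₀ (K - (J + (u + 1)))) (Averaging.iter (fun k => blockAvg (P := F.P K) (j := k) ℰp) (K - (J + (u + 1))) U₁) (bondShift (F.sitesPerDir_eq (m := F.m) (K := J + (u + 1)) (j := 0) (m' := F.m) (K' := K) (j' := (K - (J + (u + 1)))) (by omega)) ℓ'))⁻¹))) else 0)‖ ^ 2) u hu else 0, hr.1, hr.2, hbud⟩
  · -- `L = 2`: no member of the family (block sizes are odd)
    refine ⟨1, one_pos, 0, le_rfl, by norm_num, 0, le_rfl, by norm_num, 0, le_rfl, 0, le_rfl, ?_⟩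
    intro F hF
    exfalso
    have ho := F.hL.1
    rw [hF] at ho
    obtain ⟨k, hk⟩ := ho
    omega

end Summit.QuantumFields.YangMills.Theorems.FluctuationComparisonRegPrIntLS2BetaSupTowerLetterOfSuppliersAt

end
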